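import Literature.AlgebraicGeometry.AbelianSchemes.PolarizationNormalize
import Literature.AlgebraicGeometry.AbelianSchemes.PoincareNormalizeBaseChange
import Literature.AlgebraicGeometry.AbelianSchemes.AbelianSchemePolarizationBaseChange
import Literature.AlgebraicGeometry.AbelianSchemes.PolarizedAbelianSchemeWithLevelBaseChange
import HarnessLib

/-!
# Renormalisation COMMUTES with base change for polarisations: a polarisation of `A_{S′}` for `D ×_S S′` is a polarisation for
# `D.normalize ×_S S′`, with the same `λ` ([MumfordFogartyKirwan1994] Ch. 6 §2 (p. 121); [MilneAV2008] I §8)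

Layer `Literature/AlgebraicGeometry/AbelianSchemes`, namespaces `Literature.AlgebraicGeometry.AbelianSchemes.AbelianSchemeOver.DualPair` and
`….AbelianSchemeOver.Polarization`.  THEOREMS ONLY (no definition, no named fact, no instance, no notation, no `sorry`).  Cell `hodgecm-mathlib`
(D-0151), FLOOR 0, P6 «MOD programme» (crux hLiu418 = stmt-HodgeConjecture-24832), SPREAD door, item (s2-λ′) «the `hD`-free head» (LEAD heir
F0P6-plan (g3) DEAL 2026-09-01 23:25:36Z; B-p18 (g38)): the ONE lemma the (s2-λ) closer needs to normalise the stage dual pair INSIDE — the given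
generic polarisation `pol` of `(𝒜ₜ)_K` for `Dₜ ×_{P_t} (P ⊗ Spec K)` must be read as a polarisation for `Dₜ.normalize ×_{P_t} (P ⊗ Spec K)`.
HC_CM is proved only modulo the printed citations until rung 0 closes; this file is generic and changes no count.

THE POINT.  ★ `DualPair.normalize` (`(Â, 𝒫 ⊗ (pr_A^*M)^∨)`, `M := 𝒫|_{A × {ε_Â}}`) has the same `Â` (`normalize_hat`, `rfl`); ★
`Polarization.exists_normalize` moves a polarisation from `D` to `D.normalize` over the SAME base.  The two orders «normalise, then base-change»
and «base-change, then normalise» give dual pairs of `A_{S′}` with the same dual `Â ×_S S′` (definitionally) and ISOMORPHIC Poincaré sheaves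
(★ `PoincareNormalizeBaseChange.nonempty_pullback_map_normalizeP_iso`: the Poincaré clause survives renormalisation on both sides, read at the
chart `(pr_A, pr_Â)` of the chosen base change); [MumfordFogartyKirwan1994, Def. 6.3] reads `𝒫` only through the slices `A_s × {λ̄(x)}`, so a
polarisation transfers along an isomorphism of Poincaré sheaves.

* §1 `DualPair.nonempty_pullback_map_P_iso_PBaseChange` — the Poincaré clause `(pr_A ×_g pr_Â)^*𝒫 ≅ 𝒫_{S′}` of the chosen base change (the chart
  `(pr_A ×_g pr_Â)` IS ★ `prodBaseChangeToProd g`, ★ `DualPair.pullback_map_fst_fst_eq_prodBaseChangeToProd`).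
* §2 **`DualPair.nonempty_normalize_baseChange_P_iso`** — `((D.normalize).baseChange g).P ≅ ((D.baseChange g).normalize).P`.
* §3 `IsLambdaOfAt.normalize_baseChange_of_baseChange_normalize` — `IsLambdaOfAt s ((D.baseChange g).normalize) λ Θ ⇒
  IsLambdaOfAt s ((D.normalize).baseChange g) λ Θ`; **`Polarization.exists_normalize_baseChange`** — from `pol : (A ×_S S′).Polarization (D ×_S S′)`
  a polarisation for `D.normalize ×_S S′` with the same `λ`.

## References
* [MumfordFogartyKirwan1994] D. Mumford, J. Fogarty, F. Kirwan, *Geometric Invariant Theory*, 3rd ed. (1994), Ch. 6 §2 Def. 6.3 (p. 120), §2 (p. 121)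
  (normalised Poincaré sheaf); Ch. 7 §2 Def. 7.2 (p. 129) (pull-back of the data).
* [MilneAV2008] J. S. Milne, *Abelian Varieties* (v2.00, 2008), I §8 pp. 36–37.
* [GortzWedhorn2020] U. Görtz, T. Wedhorn, *Algebraic Geometry I*, 2nd ed. (2020), §(4.7) Prop. 4.16.
-/

set_option autoImplicit false

noncomputable section

-- `Scheme.Modules` / `SheafOfModules` are not reducible (as in the ★ normalisation files).
set_option backward.isDefEq.respectTransparency false

universe u

open CategoryTheory CategoryTheory.Limits AlgebraicGeometry MonoidalCategory CartesianMonoidalCategory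
open scoped MonObj

namespace Literature.AlgebraicGeometry.AbelianSchemes

namespace AbelianSchemeOver

open Literature.AlgebraicGeometry.Motives Literature.AlgebraicGeometry.AbelianVarieties Literature.AlgebraicGeometry.Modules

variable {S S' : Scheme.{u}} {A : AbelianSchemeOver S} (D : A.DualPair) (g : S' ⟶ S)

namespace DualPair

/-! ## §1 The chart of the chosen base change and its Poincaré clause -/

/-- The structure square of `A_{S′} → A`: `π_{A_{S′}} ≫ g = pr_A ≫ π_A`. [cite: GortzWedhorn2020, §(4.7) Prop. 4.16] -/
theorem baseChange_hom_comp_eq_fst_comp_hom : (A.baseChange g).X.hom ≫ g = pullback.fst A.X.hom g ≫ A.X.hom :=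
  pullback.condition.symm

/-- **The Poincaré clause of the chosen base change**: `(pr_A ×_g pr_Â)^*𝒫 ≅ 𝒫_{S′}` (`𝒫_{S′} = prodBaseChangeToProd^*𝒫` by definition).
[cite: MumfordFogartyKirwan1994, Ch. 6 §1 Cor. 6.8 (p. 118) and Ch. 7 §2 Definition 7.2 (p. 129)] -/
theorem nonempty_pullback_map_P_iso_PBaseChange :
    Nonempty ((Scheme.Modules.pullback
      (pullback.map (A.baseChange g).X.hom (D.baseChange g).hat.X.hom A.X.hom D.hat.X.hom (pullback.fst A.X.hom g)
        (pullback.fst D.hat.X.hom g) g (baseChange_hom_comp_eq_fst_comp_hom g) (baseChange_hom_comp_eq_fst_comp_hom g))).obj D.P ≅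
      (D.baseChange g).P) :=
  ⟨(Scheme.Modules.pullbackCongr (D.pullback_map_fst_fst_eq_prodBaseChangeToProd g (baseChange_hom_comp_eq_fst_comp_hom g)
    (baseChange_hom_comp_eq_fst_comp_hom g))).app D.P⟩

/-! ## §2 «normalise then base-change» versus «base-change then normalise»: isomorphic Poincaré sheaves -/

/-- **`((D.normalize) ×_S S′).𝒫 ≅ ((D ×_S S′).normalize).𝒫`** on `A_{S′} ×_{S′} Â_{S′}` (same dual `Â ×_S S′` definitionally): the left side is
`prodBaseChangeToProd^*(𝒫 ⊗ (pr_A^*M)^∨)`, the right side `𝒫_{S′} ⊗ (pr_{A_{S′}}^*M_{S′})^∨`, and ★ `nonempty_pullback_map_normalizeP_iso` (the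
Poincaré clause survives renormalisation on both sides) at the chart of §1 (`ε_{Â_{S′}} ≫ pr_Â = g ≫ ε_Â`, ★ `unitSection_baseChange_comp_fst`)
identifies them. [cite: MumfordFogartyKirwan1994, Ch. 6 §2 (p. 121)] [cite: MilneAV2008, I §8 pp. 36–37] -/
theorem nonempty_normalize_baseChange_P_iso :
    Nonempty (((D.normalize).baseChange g).P ≅ ((D.baseChange g).normalize).P) := by
  obtain ⟨i⟩ := D.nonempty_pullback_map_normalizeP_iso (D.baseChange g) (baseChange_hom_comp_eq_fst_comp_hom g)
    (baseChange_hom_comp_eq_fst_comp_hom g) (D.hat.unitSection_baseChange_comp_fst g) (D.nonempty_pullback_map_P_iso_PBaseChange g)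
  -- `((D.normalize).baseChange g).P = prodBaseChangeToProd^* D.normalizeP`
  exact ⟨(Scheme.Modules.pullbackCongr (D.pullback_map_fst_fst_eq_prodBaseChangeToProd g (baseChange_hom_comp_eq_fst_comp_hom g)
    (baseChange_hom_comp_eq_fst_comp_hom g)).symm).app D.normalizeP ≪≫ i⟩

end DualPair

/-! ## §3 Polarisations transfer -/

/-- `λ̄ = Λ(𝒪(Θ))` at `s` for `(D ×_S S′).normalize` ⇒ the same for `(D.normalize) ×_S S′` — the two dual pairs have the same dual (definitionally)
and isomorphic Poincaré sheaves (§2), and [MumfordFogartyKirwan1994, Def. 6.2–6.3] reads `𝒫` only through the slices `A_s × {λ̄(x)}`.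
[cite: MumfordFogartyKirwan1994, Ch. 6 §2 Definition 6.2–6.3 (p. 120)] -/
theorem IsLambdaOfAt.normalize_baseChange_of_baseChange_normalize {Ω : Type u} [Field Ω] (s : Spec (.of Ω) ⟶ S')
    (lam : (A.baseChange g).X ⟶ (D.baseChange g).hat.X) (Θ : CartierDivisor ((A.baseChange g).fibre s).toAbelianVariety.X.left)
    (h : (A.baseChange g).IsLambdaOfAt s (D.baseChange g).normalize lam Θ) :
    (A.baseChange g).IsLambdaOfAt s ((D.normalize).baseChange g) lam Θ := by
  obtain ⟨e⟩ := D.nonempty_normalize_baseChange_P_iso g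
  intro P
  obtain ⟨i⟩ := h P
  exact ⟨(Scheme.Modules.pullback _).mapIso e ≪≫ i⟩

/-- **A POLARISATION OF `A_{S′}` FOR `D ×_S S′` IS A POLARISATION FOR `D.normalize ×_S S′`, WITH THE SAME `λ`** (★ `Polarization.exists_normalize`
over `S′`, then §3 along the isomorphism of §2).  The (s2-λ′) use: the generic polarisation of a stage abelian scheme, read for the NORMALISED
stage dual pair, whose unit clause `𝒫|_{A × {ε_Â}} ≅ 𝒪` holds by ★ `nonempty_unitHatSlice_iso_normalize`.
[cite: MumfordFogartyKirwan1994, Ch. 6 §2 Definition 6.3 (p. 120) and §2 (p. 121)] [cite: MilneAV2008, I §8 pp. 36–37] -/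
theorem Polarization.exists_normalize_baseChange (pol : (A.baseChange g).Polarization (D.baseChange g)) :
    ∃ polN : (A.baseChange g).Polarization ((D.normalize).baseChange g), polN.lam = pol.lam := by
  obtain ⟨pol', hpol'⟩ := pol.exists_normalize
  haveI := pol'.isMonHom
  refine ⟨⟨pol'.lam, pol'.isMonHom, fun Ω _ _ s => ?_⟩, hpol'⟩
  obtain ⟨Θ, hΘ, hΛ⟩ := pol'.exists_ample Ω s
  exact ⟨Θ, hΘ, IsLambdaOfAt.normalize_baseChange_of_baseChange_normalize D g s pol'.lam Θ hΛ⟩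

end AbelianSchemeOver

end Literature.AlgebraicGeometry.AbelianSchemes

end
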